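import Mathlib
import Summits.Ventures.PercRepro2.Defs
import Summits.Ventures.PercRepro2.Independence
import Summits.Ventures.PercRepro2.Harris
import Summits.Ventures.PercRepro2.Graph
import Summits.Ventures.PercRepro2.Exploration
import Summits.Ventures.PercRepro2.Events
import Summits.Ventures.PercRepro2.FourFunctions
import Summits.Ventures.PercRepro2.Induced
import Summits.Ventures.PercRepro2.Frontier
import Summits.Ventures.PercRepro2.ObsIndependence
import Summits.Ventures.PercRepro2.BHK
import Summits.Ventures.PercRepro2.BHKEvents
import Summits.Ventures.PercRepro2.OrderPreservation
import Summits.Ventures.PercRepro2.BHKAvoid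
import Summits.Ventures.PercRepro2.SameClusterAvoid
import Summits.Ventures.PercRepro2.CaseOneRegime
import Summits.Ventures.PercRepro2.CaseOnePos
import Summits.Ventures.PercRepro2.CaseOneJ11
import Summits.Ventures.PercRepro2.CaseOneRV
import Summits.Ventures.PercRepro2.CaseOnePendant
import Summits.Ventures.PercRepro2.CaseOnePendantAny
import Summits.Ventures.PercRepro2.CaseOnePendantNec
import Summits.Ventures.PercRepro2.HullDefs
import Summits.Ventures.PercRepro2.OneEdge
import Summits.Ventures.PercRepro2.HCov
import Summits.Ventures.PercRepro2.HCovSwap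
import Summits.Ventures.PercRepro2.OddsLemma
import Summits.Ventures.PercRepro2.RV
import Summits.Ventures.PercRepro2.RVBridge
import Summits.Ventures.PercRepro2.CaseOneDWorld
import Summits.Ventures.PercRepro2.CaseOneDWorldPin

/-!
# Root edges at `a₃` are free in the D-world: identity (E) (blind cell PercRepro2, p1 g14; S5 §2.1
(K9), proofs/P1-DWORLD.md §2, identity (E), part 2)

With the pinning facts of `CaseOneDWorldPin.lean`, for an edge `e₁ = {a₁, a₃}` of weight `p₁` and
`p₀ := p[e₁ ↦ 0]`:

  **`iiExprD_a1_edge`**:  `iiExprD p c₀ c₁ = p₁ · c₁ · [P₀(D) P₀(D, b, o ∈ C₂) − P₀(D, b ∈ C₂) P₀(D, o ∈ C₂)] + (1 − p₁) · iiExprD p₀ c₀ c₁`,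

with the bracket `≥ 0` by BHK 1.3 for the cluster of `a₂` avoiding `{a₁, a₃}` (**`covDw_nonneg`**), so
**`zSplitIID_of_a1_edge`**: `ZSplitIID p₀ ⟹ ZSplitIID p` (any multiplicity, by iteration). An edge
`e₂ = {a₂, a₃}` is closed on `D` and on `PD`: every mass picks up the factor `1 − p₂`
(`prob_a2_edge_of_subset_Dw`), **`iiExprD_a2_edge`**: `iiExprD p = (1 − p₂)² · iiExprD p₀`, and
**`zSplitIID_of_a2_edge`**. Together: in the D-world `a₃` may be assumed to have no root edges, and
the PD threshold `γ` is unchanged by deleting them. Own code; standard axioms.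
-/

namespace Summit.Ventures.PercRepro2

namespace CaseOne

/-! ## Identity (E) and its consequence -/

section IdentityE
variable {V : Type*} {E : Type*} [Fintype E] [DecidableEq E] {R : Type*} [CommRing R]
variable {ends : E → Sym2 V} {a₁ a₂ a₃ : V} {e₁ : E}

/-- `iiExprD` is homogeneous in the threshold pair. -/
lemma iiExprD_smul (p : E → R) (ends : E → Sym2 V) (o a₁ a₂ a₃ b : V) (t c₀ c₁ : R) :
    iiExprD p ends o a₁ a₂ a₃ b (t * c₀) (t * c₁) = t * iiExprD p ends o a₁ a₂ a₃ b c₀ c₁ := by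
  rw [iiExprD_eq, iiExprD_eq]
  ring

/-- **Identity (E)**: pinning an `a₁a₃`-edge `e₁` of weight `p₁`,
`iiExprD p c₀ c₁ = p₁ · c₁ · [P₀(D) P₀(D, b, o ∈ C₂) − P₀(D, b ∈ C₂) P₀(D, o ∈ C₂)] + (1 − p₁) · iiExprD p₀ c₀ c₁`
with `p₀ = p[e₁ ↦ 0]`. -/
theorem iiExprD_a1_edge (p : E → R) (he : ends e₁ = s(a₁, a₃)) (o b : V) (c₀ c₁ : R) :
    iiExprD p ends o a₁ a₂ a₃ b c₀ c₁ =
      p e₁ * c₁ * (prob (Function.update p e₁ 0) (Dw ends a₁ a₂ a₃) *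
          prob (Function.update p e₁ 0) (connEvent ends a₂ b ∩ connEvent ends a₂ o ∩
            Dw ends a₁ a₂ a₃) -
        prob (Function.update p e₁ 0) (connEvent ends a₂ b ∩ Dw ends a₁ a₂ a₃) *
          prob (Function.update p e₁ 0) (connEvent ends a₂ o ∩ Dw ends a₁ a₂ a₃)) +
      (1 - p e₁) * iiExprD (Function.update p e₁ 0) ends o a₁ a₂ a₃ b c₀ c₁ := by
  rw [iiExprD_eq, iiExprD_eq]
  -- the `A`-masses in their `D`-forms
  rw [← BAO_inter_Dw, ← AO_inter_Dw, ← BA_inter_Dw, ← A_inter_Dw]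
  have hB := a2_event_update (a₂ := a₂) he b
  have hO := a2_event_update (a₂ := a₂) he o
  have hBO := inter_event_update hB hO
  have hU := univ_event_update (ends := ends) (a₁ := a₁) (a₂ := a₂) (a₃ := a₃) (e₁ := e₁)
  -- `P(D)` and `P(D, b ∈ C₂)` ignore `e₁`
  have hd : prob p (Dw ends a₁ a₂ a₃) = prob (Function.update p e₁ 0) (Dw ends a₁ a₂ a₃) := by
    have := prob_inter_Dw_update p he Set.univ hU 0
    rw [Set.univ_inter] at this
    exact this.symm
  have hdB : prob p (connEvent ends a₂ b ∩ Dw ends a₁ a₂ a₃) =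
      prob (Function.update p e₁ 0) (connEvent ends a₂ b ∩ Dw ends a₁ a₂ a₃) :=
    (prob_inter_Dw_update p he _ hB 0).symm
  -- the four `A`-masses
  have e1 : connEvent ends a₂ b ∩ connEvent ends a₁ a₃ ∩ connEvent ends a₂ o ∩ Dw ends a₁ a₂ a₃ =
      (connEvent ends a₂ b ∩ connEvent ends a₂ o) ∩ connEvent ends a₁ a₃ ∩ Dw ends a₁ a₂ a₃ := by
    ext ω; simp only [Set.mem_inter_iff]; tauto
  have e2 : connEvent ends a₁ a₃ ∩ connEvent ends a₂ o ∩ Dw ends a₁ a₂ a₃ =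
      connEvent ends a₂ o ∩ connEvent ends a₁ a₃ ∩ Dw ends a₁ a₂ a₃ := by
    ext ω; simp only [Set.mem_inter_iff]; tauto
  have hBAO := prob_A_inter_Dw_pin p he _ hBO
  have hAO := prob_A_inter_Dw_pin p he _ hO
  have hBA := prob_A_inter_Dw_pin p he _ hB
  have hA := prob_A_inter_Dw_pin p he _ hU
  rw [Set.univ_inter, Set.univ_inter] at hA
  rw [e1, e2, hBAO, hAO, hBA, hA, hd, hdB]
  ring

end IdentityE

section IdentityEOrder
variable {V : Type*} {E : Type*} [Fintype E] [DecidableEq E] [Fintype V] [DecidableEq V]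
  {R : Type*} [CommRing R] [LinearOrder R] [IsStrictOrderedRing R]
variable {ends : E → Sym2 V} {a₁ a₂ a₃ : V} {e₁ : E}

/-- **BHK 1.3 in the D-world**: `P(D, b ∈ C₂) P(D, o ∈ C₂) ≤ P(D, b, o ∈ C₂) P(D)` (the cluster of
`a₂` avoiding `{a₁, a₃}`). -/
theorem covDw_nonneg (p : E → R) (hp : IsProbVec p) (ends : E → Sym2 V) (o a₁ a₂ a₃ b : V) :
    0 ≤ prob p (Dw ends a₁ a₂ a₃) *
        prob p (connEvent ends a₂ b ∩ connEvent ends a₂ o ∩ Dw ends a₁ a₂ a₃) -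
      prob p (connEvent ends a₂ b ∩ Dw ends a₁ a₂ a₃) *
        prob p (connEvent ends a₂ o ∩ Dw ends a₁ a₂ a₃) := by
  have h := bhk_same_cluster_events_avoid p hp ends a₂ ({a₁, a₃} : Finset V)
    (isUpperSet_mem_setOf b) (isUpperSet_mem_setOf o)
  have e1 : clusterInEvent ends a₂ ({W : Set V | b ∈ W} ∩ {W | o ∈ W}) =
      connEvent ends a₂ b ∩ connEvent ends a₂ o := by
    ext ω; simp [clusterInEvent]
  rw [e1, ← connEvent_eq_clusterInEvent ends a₂ b, ← connEvent_eq_clusterInEvent ends a₂ o,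
    ← Dw_eq_avoidAll] at h
  linarith [h]

/-- **`ZSplitIID` lifts along an `a₁a₃`-edge**: `ZSplitIID p[e₁ ↦ 0] ⟹ ZSplitIID p`. -/
theorem zSplitIID_of_a1_edge (p : E → R) (hp : IsProbVec p) (he : ends e₁ = s(a₁, a₃)) (o b : V)
    (h : ZSplitIID (Function.update p e₁ 0) ends o a₁ a₂ a₃ b) : ZSplitIID p ends o a₁ a₂ a₃ b := by
  unfold ZSplitIID at h ⊢
  rw [iiExprD_a1_edge p he o b, Dpd_a1_edge p he, Dpdo_a1_edge p he o, iiExprD_smul]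
  have hp0 : IsProbVec (Function.update p e₁ 0) := hp.update e₁ le_rfl zero_le_one
  have hcov := covDw_nonneg (Function.update p e₁ 0) hp0 ends o a₁ a₂ a₃ b
  have h1 : 0 ≤ p e₁ := hp.nonneg e₁
  have h2 : 0 ≤ 1 - p e₁ := by linarith [hp.le_one e₁]
  have hD : 0 ≤ Dpd (Function.update p e₁ 0) ends a₁ a₂ a₃ := prob_nonneg hp0 _
  have t1 : 0 ≤ p e₁ * ((1 - p e₁) * Dpd (Function.update p e₁ 0) ends a₁ a₂ a₃) *
      (prob (Function.update p e₁ 0) (Dw ends a₁ a₂ a₃) *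
          prob (Function.update p e₁ 0) (connEvent ends a₂ b ∩ connEvent ends a₂ o ∩
            Dw ends a₁ a₂ a₃) -
        prob (Function.update p e₁ 0) (connEvent ends a₂ b ∩ Dw ends a₁ a₂ a₃) *
          prob (Function.update p e₁ 0) (connEvent ends a₂ o ∩ Dw ends a₁ a₂ a₃)) :=
    mul_nonneg (mul_nonneg h1 (mul_nonneg h2 hD)) hcov
  have t2 : 0 ≤ (1 - p e₁) * ((1 - p e₁) * iiExprD (Function.update p e₁ 0) ends o a₁ a₂ a₃ b
      (Dpdo (Function.update p e₁ 0) ends o a₁ a₂ a₃) (Dpd (Function.update p e₁ 0) ends a₁ a₂ a₃)) :=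
    mul_nonneg h2 (mul_nonneg h2 h)
  linarith [t1, t2]

end IdentityEOrder

/-! ## An `a₂a₃`-edge is closed on the D-world -/

section A2Edge
variable {V : Type*} {E : Type*} [Fintype E] [DecidableEq E] {R : Type*} [CommRing R]
variable {ends : E → Sym2 V} {a₁ a₂ a₃ : V} {e₂ : E}

omit [Fintype E] [DecidableEq E] in
/-- On `D`, an `a₂a₃`-edge is closed. -/
lemma update_false_of_mem_Dw (he : ends e₂ = s(a₂, a₃)) {ω : Config E} (h : ω ∈ Dw ends a₁ a₂ a₃) :
    ω e₂ = false := by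
  by_contra hc
  have hc' : ω e₂ = true := by simpa using hc
  exact h.2 (conn_of_openAdj ⟨e₂, hc', he⟩)

/-- **Every event inside `D` picks up the factor `1 − p₂`** under the pinning of an `a₂a₃`-edge. -/
theorem prob_a2_edge_of_subset_Dw (p : E → R) (he : ends e₂ = s(a₂, a₃)) {Y : Set (Config E)}
    (hY : Y ⊆ Dw ends a₁ a₂ a₃) : prob p Y = (1 - p e₂) * prob (Function.update p e₂ 0) Y := by
  rw [prob_eq_expect_indicator, expect_eq_update_pin p _ e₂, prob_eq_expect_indicator,
    expect_update_zero]
  have h1 : expect p (fun ω => Y.indicator (1 : Config E → R) (Function.update ω e₂ true)) = 0 := by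
    unfold expect
    refine Finset.sum_eq_zero fun ω _ => ?_
    dsimp only
    rw [Set.indicator_of_notMem]
    · ring
    · intro h
      have := update_false_of_mem_Dw he (hY h)
      simp at this
  rw [h1]
  ring

/-- **Identity (E′)**: `iiExprD p = (1 − p₂)² · iiExprD p₀` for an `a₂a₃`-edge `e₂`. -/
theorem iiExprD_a2_edge (p : E → R) (he : ends e₂ = s(a₂, a₃)) (o b : V) (c₀ c₁ : R) :
    iiExprD p ends o a₁ a₂ a₃ b c₀ c₁ =
      (1 - p e₂) ^ 2 * iiExprD (Function.update p e₂ 0) ends o a₁ a₂ a₃ b c₀ c₁ := by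
  rw [iiExprD_eq, iiExprD_eq]
  rw [← BAO_inter_Dw, ← AO_inter_Dw, ← BA_inter_Dw, ← A_inter_Dw]
  rw [prob_a2_edge_of_subset_Dw p he (Y := Dw ends a₁ a₂ a₃) (fun _ h => h),
    prob_a2_edge_of_subset_Dw p he (Y := connEvent ends a₂ b ∩ Dw ends a₁ a₂ a₃) (fun _ h => h.2),
    prob_a2_edge_of_subset_Dw p he (Y := connEvent ends a₂ b ∩ connEvent ends a₁ a₃ ∩
      connEvent ends a₂ o ∩ Dw ends a₁ a₂ a₃) (fun _ h => h.2),
    prob_a2_edge_of_subset_Dw p he (Y := connEvent ends a₁ a₃ ∩ connEvent ends a₂ o ∩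
      Dw ends a₁ a₂ a₃) (fun _ h => h.2),
    prob_a2_edge_of_subset_Dw p he (Y := connEvent ends a₂ b ∩ connEvent ends a₁ a₃ ∩
      Dw ends a₁ a₂ a₃) (fun _ h => h.2),
    prob_a2_edge_of_subset_Dw p he (Y := connEvent ends a₁ a₃ ∩ Dw ends a₁ a₂ a₃) (fun _ h => h.2)]
  ring

/-- `D(p) = (1 − p₂) D(p₀)` for an `a₂a₃`-edge. -/
theorem Dpd_a2_edge (p : E → R) (he : ends e₂ = s(a₂, a₃)) :
    Dpd p ends a₁ a₂ a₃ = (1 - p e₂) * Dpd (Function.update p e₂ 0) ends a₁ a₂ a₃ := by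
  unfold Dpd
  exact prob_a2_edge_of_subset_Dw p he (fun _ h => ⟨h.2, h.1.2⟩)

/-- `D_o(p) = (1 − p₂) D_o(p₀)` for an `a₂a₃`-edge. -/
theorem Dpdo_a2_edge (p : E → R) (he : ends e₂ = s(a₂, a₃)) (o : V) :
    Dpdo p ends o a₁ a₂ a₃ = (1 - p e₂) * Dpdo (Function.update p e₂ 0) ends o a₁ a₂ a₃ := by
  unfold Dpdo
  exact prob_a2_edge_of_subset_Dw p he (fun _ h => ⟨h.2, h.1.2⟩)

end A2Edge

section A2EdgeOrder
variable {V : Type*} {E : Type*} [Fintype E] [DecidableEq E] {R : Type*} [CommRing R]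
  [LinearOrder R] [IsStrictOrderedRing R]
variable {ends : E → Sym2 V} {a₁ a₂ a₃ : V} {e₂ : E}

/-- **`ZSplitIID` lifts along an `a₂a₃`-edge**: `ZSplitIID p[e₂ ↦ 0] ⟹ ZSplitIID p`. -/
theorem zSplitIID_of_a2_edge (p : E → R) (hp : IsProbVec p) (he : ends e₂ = s(a₂, a₃)) (o b : V)
    (h : ZSplitIID (Function.update p e₂ 0) ends o a₁ a₂ a₃ b) : ZSplitIID p ends o a₁ a₂ a₃ b := by
  unfold ZSplitIID at h ⊢
  rw [iiExprD_a2_edge p he o b, Dpd_a2_edge p he, Dpdo_a2_edge p he o, iiExprD_smul]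
  have h2 : 0 ≤ 1 - p e₂ := by linarith [hp.le_one e₂]
  exact mul_nonneg (pow_nonneg h2 2) (mul_nonneg h2 h)

end A2EdgeOrder

end CaseOne

end Summit.Ventures.PercRepro2
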